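import Summits.BirchSwinnertonDyer.BirchSwinnertonDyer.Theorems.AdditiveBranchIMCMultLowerCruxShape

/-!
# K1 route `AdditiveBranchIMC` — glue item 19593 `MultLowerOfParts` of the tenure split (§C v2) of crux
# `MultLower` (item 19359), PROVED OUTRIGHT (cell `bsd-addord`, seat `bsd-addord-k1-c4` gen 3)

Item `stmt-BirchSwinnertonDyer-19593` (support, GLUE of the gen-2 split of crux 19359, K1 rev 11):
`MultLowerOfParts := DelbourgoPotMultUnit → PalQuadraticTwistPeriod → DelbourgoLeadingTermPotMult →
MultModularityInputs → MultLambdaLower → MultSchneiderNondegeneracy → MultBranchPAdicGrossZagierAt → MultLower`.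

The seven children are, by construction of the split, exactly the eight binders of this seat's gen-2 theorem
`multLower_of_facts_of_quadraticBranchLower_of_branchPAdicGrossZagierMult`
(`…Theorems.AdditiveBranchIMCMultLowerCruxShape`, p426893): the three alias leaves `DelbourgoPotMultUnit` /
`PalQuadraticTwistPeriod` / `DelbourgoLeadingTermPotMult` unfold definitionally to the binders `hDelX` / `hPal` /
`hDelM`; the alias child `MultModularityInputs` is the conjunction of the binders `hGZK ∧ hmod ∧ hmodD`; the content
crux `MultLambdaLower` is binder `hΛ` verbatim; and the binder `hGZ` (`SchneiderConjecture Dh ∧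
BranchPAdicGrossZagierMultAt W p Dh` at every rank-1 (M) pair and every height datum satisfying Delbourgo's
leading-term clauses) is re-paired from the two content cruxes `MultSchneiderNondegeneracy` and
`MultBranchPAdicGrossZagierAt`. So the glue is the planner's three-line wrapper (plan g15,
`pub/bsd-addord/planner/resplit19359/Sketch19359.lean`), landed against the route declaration.

HONEST FRAMING. No mathematics of the crux is touched here: the content children 19590 (Λ-adic lower
containment on the ω^{(p−1)/2}-branch at the MULTIPLICATIVE twist model — NOT in print), 19591 (Schneider
non-degeneracy on (M) in rank 1) and 19592 (branch p-adic Gross–Zagier at potentially multiplicative p) remain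
OPEN, and so does BSD; closing the glue only certifies that the children imply the parent BY NAME.
-/

set_option autoImplicit false
set_option linter.dupNamespace false

namespace Summit.BirchSwinnertonDyer.BirchSwinnertonDyer.Theorems.AdditiveBranchIMCMultLower

open Summit.BirchSwinnertonDyer.BirchSwinnertonDyer.Theses.AdditiveBranchIMC

/-- **Glue item 19593, proved outright**: the seven split children of crux `MultLower` imply it, by
`multLower_of_facts_of_quadraticBranchLower_of_branchPAdicGrossZagierMult` (gen 2, p426893) applied to the
children in order — the modularity bundle `MultModularityInputs` split into its three components and the
Schneider / branch-Gross–Zagier children re-paired into the binder `hGZ`. Pure bookkeeping; nothing about any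
curve is asserted. [cite: Delbourgo1998, Main Conjecture (p. 151) (shape)]
[cite: Delbourgo2002, Theorem (A), (B) (p. 40)] [cite: Miller2011LMS, Def. 1.1] -/
theorem multLowerOfParts_proof : MultLowerOfParts := by
  unfold MultLowerOfParts
  intro h1 h2 h3 h4 h5 hS hGZ
  exact multLower_of_facts_of_quadraticBranchLower_of_branchPAdicGrossZagierMult h1 h2 h3 h4.1 h4.2.1
    h4.2.2 h5 (fun W _ _ p _ hc hr Dh hL => ⟨hS W p hc hr Dh hL, hGZ W p hc hr Dh hL⟩)

end Summit.BirchSwinnertonDyer.BirchSwinnertonDyer.Theorems.AdditiveBranchIMCMultLower
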